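import Literature.MathematicalPhysics.QuantumFieldTheory.QCDFlavourSymmetry
import Literature.MathematicalPhysics.QuantumFieldTheory.QCDObservableAxisPermutation
import Summits.QuantumFields.QCD.Theorems.QuarksNoInfraredClauseTorusHalfSpectrumStubNeutralGapAlongAxes
import HarnessLib

/-!
# Crux `TorusHalfSpectrum` (stmt-QuantumFields-9508), line `registered` (`Lines/birth.lean`, reshape v5) —
# stub `stub_charged_axis_transport`: charged hypercubic transport of a pair correlator to the time axis

Stub E2 of the birth skeleton of the crux
`Summit.QuantumFields.QCD.Theses.QuarksNoInfraredClause.TorusHalfSpectrum` (= `ChargedTransportStmt`):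
for every pair of gauge-invariant local observables `A, B` and every SPATIAL axis `i ≠ 0` there is a pair
`A₁, B₁` with the SAME flavour charges (every flavour-homogeneity `t · A = (∏_f t_f^{q_f}) A` of `A` is
inherited by `A₁`, and likewise for `B`, `B₁`) such that on every torus, for every coupling, every bare-mass
vector and every separation `n`, the pair correlator of `A(0), B(n eᵢ)` along the axis `i` and the two
one-point functions are those of `A₁(0), B₁(n e₀)` along the Euclidean-time axis.  (In Haag's splitting
identity on the symmetric torus this turns the long-range-order term at spatial distance `S` into the
antipodal TEMPORAL charged correlator, an instance of the crux's goal.)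

Proof (the pattern of `QCDScheme.HasLatticeMassGap.along_axis` and of the landed neutral twin
`NeutralGapAlongAxes.stub_neutral_gap_along_axes`): the witnesses are the axis-permuted observables
`A₁ = A.axisPerm π Σ Σ'`, `B₁ = B.axisPerm π Σ Σ'` for the transposition `π = (0 i)` and its spinor
intertwiner `Σ = transpositionSpinor 0 i`, `Σ' = transpositionSpinorInv 0 i`
(`transpositionSpinor_intertwines`).  Homogeneity of any charge `q` is preserved because the vector flavour
torus commutes with the axis permutation of the boxed quark algebra
(`NeutralGapAlongAxes.flavourScale_boxAxisPerm`, `QCDLatticeObservable.axisPerm_F`, linearity of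
`boxAxisPerm`).  The expectation identities are the hypercubic covariance of the honest functional,
`qcdTorusExpect_axisPerm_onTorus(_mul)`, at the sites `π 0 = 0` (`sitePermZd_zero`) and
`π (n eᵢ) = n e₀` (`sitePermZd_single`).  Everything is proved (no named fact); sources as in
`QCDObservableAxisPermutation.lean` (Montvay–Münster 1994 §4.2, §5.1; Osterwalder–Seiler 1978 §2).
-/

noncomputable section

namespace Summit.QuantumFields.QCD.Cruxes.TorusHalfSpectrum.Birth.ChargedTransport

open scoped BigOperators
open Literature.MathematicalPhysics.QuantumFieldTheory

variable {Nf R : ℕ}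

/-! ### Flavour homogeneity is preserved by the axis permutation -/

/-- **The axis permutation of a flavour-homogeneous observable is flavour-homogeneous of the same charge**:
if `t · A(U) = (∏_f t_f^{q_f}) A(U)` for all `t ∈ (ℂˣ)^{N_f}` and all `U`, then the same holds for
`A.axisPerm π Σ Σ'` — the flavour torus commutes with `boxAxisPerm` (`flavourScale_boxAxisPerm`), which is
linear. -/
theorem homogeneous_axisPerm {A : QCDLatticeObservable Nf R} {q : Fin Nf → ℤ}
    (hA : ∀ t : Fin Nf → ℂ, (∀ f, t f ≠ 0) → ∀ U,
      QCDLatticeObservable.flavourScale t (A.F U) = (∏ f, t f ^ (q f)) • A.F U)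
    (π : Equiv.Perm (Fin 4)) (S S' : Matrix (Fin 4) (Fin 4) ℂ) :
    ∀ t : Fin Nf → ℂ, (∀ f, t f ≠ 0) → ∀ U,
      QCDLatticeObservable.flavourScale t ((A.axisPerm π S S').F U) =
        (∏ f, t f ^ (q f)) • (A.axisPerm π S S').F U := by
  intro t ht U
  rw [QCDLatticeObservable.axisPerm_F, NeutralGapAlongAxes.flavourScale_boxAxisPerm, hA t ht, map_smul]

/-! ### The registered stub -/

/-- **Stub `stub_charged_axis_transport` (E2) of the birth skeleton of `TorusHalfSpectrum`
(= `ChargedTransportStmt` unfolded)**: for `i ≠ 0`, the pair correlator `⟨A(0) B(n eᵢ)⟩` and the one-point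
functions `⟨A(0)⟩`, `⟨B(n eᵢ)⟩` on every torus equal the time-axis quantities `⟨A₁(0) B₁(n e₀)⟩`, `⟨A₁(0)⟩`,
`⟨B₁(n e₀)⟩` of the axis-permuted pair `A₁ = A.axisPerm (0 i) Σ Σ'`, `B₁ = B.axisPerm (0 i) Σ Σ'`
(`transpositionSpinor_intertwines`, `qcdTorusExpect_axisPerm_onTorus(_mul)`, `sitePermZd_zero`,
`sitePermZd_single`), and `A₁`, `B₁` inherit every flavour-homogeneity of `A`, `B` (`homogeneous_axisPerm`). -/
theorem stub_charged_axis_transport :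
    ∀ (Nf R R' : ℕ) (A : QCDLatticeObservable Nf R) (B : QCDLatticeObservable Nf R') (i : Fin 4), i ≠ 0 →
      ∃ (A₁ : QCDLatticeObservable Nf R) (B₁ : QCDLatticeObservable Nf R'),
        (∀ q : Fin Nf → ℤ,
          (∀ t : Fin Nf → ℂ, (∀ f, t f ≠ 0) → ∀ U,
              QCDLatticeObservable.flavourScale t (A.F U) = (∏ f, t f ^ (q f)) • A.F U) →
          ∀ t : Fin Nf → ℂ, (∀ f, t f ≠ 0) → ∀ U,
              QCDLatticeObservable.flavourScale t (A₁.F U) = (∏ f, t f ^ (q f)) • A₁.F U) ∧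
        (∀ q : Fin Nf → ℤ,
          (∀ t : Fin Nf → ℂ, (∀ f, t f ≠ 0) → ∀ U,
              QCDLatticeObservable.flavourScale t (B.F U) = (∏ f, t f ^ (q f)) • B.F U) →
          ∀ t : Fin Nf → ℂ, (∀ f, t f ≠ 0) → ∀ U,
              QCDLatticeObservable.flavourScale t (B₁.F U) = (∏ f, t f ^ (q f)) • B₁.F U) ∧
        ∀ (β : ℝ) (S : ℕ) [NeZero S] (mq : Fin Nf → ℝ) (n : ℤ),
          qcdTorusExpect β S mq (fun U => A.onTorus S 0 U * B.onTorus S (Pi.single i n) U) =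
              qcdTorusExpect β S mq (fun U => A₁.onTorus S 0 U * B₁.onTorus S (Pi.single 0 n) U) ∧
            qcdTorusExpect β S mq (A.onTorus S 0) = qcdTorusExpect β S mq (A₁.onTorus S 0) ∧
            qcdTorusExpect β S mq (B.onTorus S (Pi.single i n)) =
              qcdTorusExpect β S mq (B₁.onTorus S (Pi.single 0 n)) := by
  intro Nf R R' A B i hi
  -- the spinor intertwiner of the transposition `(0 i)`
  have hS := transpositionSpinor_intertwines hi.symm
  refine ⟨A.axisPerm (Equiv.swap 0 i) (transpositionSpinor 0 i) (transpositionSpinorInv 0 i),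
    B.axisPerm (Equiv.swap 0 i) (transpositionSpinor 0 i) (transpositionSpinorInv 0 i),
    fun q hA => homogeneous_axisPerm hA _ _ _, fun q hB => homogeneous_axisPerm hB _ _ _, ?_⟩
  intro β S _ mq n
  -- the permuted sites: `π 0 = 0`, `π (n eᵢ) = n e₀`
  have h0 : sitePermZd (Equiv.swap 0 i) (0 : _root_.Literature.Probability.LatticeModels.Site 4) = 0 :=
    sitePermZd_zero _
  have hn : sitePermZd (Equiv.swap 0 i)
      (Pi.single i n : _root_.Literature.Probability.LatticeModels.Site 4) = Pi.single 0 n := by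
    rw [sitePermZd_single, Equiv.swap_apply_right]
  -- hypercubic covariance of the honest functional (two-point and one-point versions)
  have h2 := qcdTorusExpect_axisPerm_onTorus_mul (T := S) hS β mq A B 0 (Pi.single i n)
  have hA₁ := qcdTorusExpect_axisPerm_onTorus (T := S) hS β mq A 0
  have hB₁ := qcdTorusExpect_axisPerm_onTorus (T := S) hS β mq B (Pi.single i n)
  rw [h0, hn] at h2
  rw [h0] at hA₁
  rw [hn] at hB₁
  exact ⟨h2.symm, hA₁.symm, hB₁.symm⟩

end Summit.QuantumFields.QCD.Cruxes.TorusHalfSpectrum.Birth.ChargedTransport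

end
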